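import Literature.Geometry.Riemannian.SurgicalSolutionsCount
import Literature.Geometry.Riemannian.HamiltonPICHolds
import HarnessLib

/-!
# `hamilton_chen_tang_zhu`: decomposition into Chen–Zhu's surgery step and Cerf's theorem

Fact-decomposition file (librarian, mode `fact-decompose`, 2026-08-16) for the named fact
`Literature.Geometry.Riemannian.hamilton_chen_tang_zhu` (`HamiltonPIC.lean`; R. Hamilton,
Comm. Anal. Geom. 5 (1997), Cor. 1.2(a) of Thm. 1.1; complete proof B.-L. Chen, X.-P. Zhu,
J. Differential Geom. 74 (2006), Thm. 1.1 / Thm. 5.6): a compact simply connected 4-manifold with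
a metric of positive isotropic curvature is diffeomorphic to `S⁴`.

The tree reduces the fact, by theorems only, along the printed proof
(`HamiltonPICHolds.lean`, `SurgicalSolutions.lean`, `SurgicalSolutionsCount.lean`,
`SurgicalRicciFlowBridge.lean`, `CerfPropositionFour.lean`):

`hamilton_chen_tang_zhu ⇐ (Chen–Zhu Thm. 1.1) ∧ (Cerf, π₀ Diff(D³ rel ∂) = 0)`,
`Thm. 1.1 ⇐ Thm. 5.6 ⇐ base of the induction (PROVED, `exists_first_stage_chenZhuAPriori`) +
the surgery step at one singular time with admissible restart data`
(`chenZhu_ricciFlowWithSurgery_of_step`). The two leaves are therefore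

* Cerf's theorem, already the named fact
  `Literature.Topology.FourManifolds.cerf_pi0DiffDisc_relBoundary_three` (not restated here), and
* **Chen–Zhu 2006, §5: the surgery step with admissible restart data** — Lemma 5.2 (fine necks at
  the singular time under the canonical neighbourhood assumption), Lemma 5.3 and the surgery
  procedures (1)–(4) (pinching survives surgery), Prop. 5.4 / Lemma 5.5 (the canonical
  neighbourhood assumption is restored after surgery, with non-increasing parameters), and the
  accounting of p. 43 (each `δ`-cutoff removes volume `≥ h⁴`, `dV/dt ≤ 0`) — in the exact form
  consumed by the count `chenZhu_surgicalSolution_existence_of_step`: child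
  `chenZhu_surgicalStep_admissibleRestart` below (the whole analytic theory of Chen–Zhu §§3–5
  behind Thm. 5.6, minus the base case and the finiteness count, both proved in the tree).

`hamilton_chen_tang_zhu_holds_of` PROVES the parent from the child and Cerf's fact by composing
`chenZhu_ricciFlowWithSurgery_of_step` with `hamilton_chen_tang_zhu_of_chenZhu_of_cerfRelBoundary`.
The child does not restate the parent: it is an existence statement for surgically modified
Ricci flows with a priori estimates, not a classification (cf. the review note in
`HamiltonPICHolds.lean` on why Thm. 1.1's bare structure statement was NOT an admissible child —
it is equivalent to the parent; the present child carries the a priori assumptions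
`ChenZhuAPriori`, the surgery relation `IsSurgeryStep` and the volume accounting, none of which
follows from the classification). This child is filed under the explicit exception to D-0027 A7
granted for the capped facts of batch `libsplit-28`.

## References

* B.-L. Chen, X.-P. Zhu, *Ricci flow with surgery on four-manifolds with positive isotropic
  curvature*, J. Differential Geom. 74 (2006) 177–264 (arXiv:math/0504478): §5, Lemma 5.2,
  Lemma 5.3, Prop. 5.4, Lemma 5.5, Thm. 5.6 and p. 43 "Summing up". [ChenZhu2006]
* R. S. Hamilton, Comm. Anal. Geom. 5 (1997) 1–92, Thm. 1.1, Cor. 1.2(a), §1.1. [Hamilton1997]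
* J. Cerf, *Sur les difféomorphismes de la sphère de dimension trois (Γ₄ = 0)*, LNM 53 (1968),
  Ch. I §2 (2). [CerfDiffeoSphere1968]
-/

noncomputable section

open Bundle Set Function TopologicalSpace
open scoped Manifold ContDiff Topology ENNReal

namespace Literature.Geometry.Riemannian

open Lorentzian Literature.Topology.FourManifolds

/-- **Chen–Zhu 2006, §5: the surgery step at one singular time, with admissible restart data
(child of `hamilton_chen_tang_zhu`).** There are universal `η > 0` and `ε₀ > 0` such that for
every `0 < ε ≤ ε₀` there are `C₁, C₂ > 0` with: for every closed simply connected 4-manifold `M`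
with a Riemannian metric `g₀` of positive isotropic curvature there are pinching/neck parameters
`ρ, Λ, P > 0`, a positive non-increasing canonical-neighbourhood scale `r(t)`, a class `Inv` of
admissible restart data containing `(M, g₀)` at time `0` (the base of the induction of §5,
p. 26), a uniform cutoff-volume scale `h > 0` and a time bound `T_max ≤ 2/α` for every positive
lower bound `α` of `R(g₀)` (p. 30), such that the surgery step `ChenZhuSurgicalStepHyp` holds:
from any admissible data the maximal Ricci flow exists and satisfies the a priori assumptions
`ChenZhuAPriori ⟨ε, C₁, C₂, η, ρ, Λ, P, r⟩` (pinching and canonical neighbourhoods, Prop. 5.4 /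
Lemma 5.5), ends before `T_max`, and at the singular time either the manifold is a finite union
of the standard pieces or one surgery (`IsSurgeryStep`, Lemma 5.2, Lemma 5.3 and procedures
(1)–(4)) produces admissible data again, with the volume/component accounting of p. 43. This is
the analytic content of Thm. 5.6 beyond its base case and the finiteness count (both proved:
`exists_first_stage_chenZhuAPriori`, `ChenZhuSurgicalFlowIn.exists_of_step`); verbatim the
hypothesis of `chenZhu_surgicalSolution_existence_of_step`.
[cite: ChenZhu2006, §5: Lemma 5.2, Lemma 5.3, Prop. 5.4, Lemma 5.5, Thm. 5.6, p. 43] -/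
def chenZhu_surgicalStep_admissibleRestart : Prop :=
  ∃ η : ℝ, 0 < η ∧ ∃ ε₀ : ℝ, 0 < ε₀ ∧ ∀ ε : ℝ, 0 < ε → ε ≤ ε₀ →
    ∃ C₁ C₂ : ℝ, 0 < C₁ ∧ 0 < C₂ ∧
    ∀ (M : Type) [TopologicalSpace M] [T2Space M] [SecondCountableTopology M] [CompactSpace M]
      [ChartedSpace (EuclideanSpace ℝ (Fin 4)) M] [IsManifold (𝓡 4) ∞ M]
      [SimplyConnectedSpace M] [MeasurableSpace M] [BorelSpace M]
      (g₀ : PseudoRiemannianMetric (𝓡 4) ∞ (EuclideanSpace ℝ (Fin 4))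
        (TangentSpace (𝓡 4) : M → Type _)),
      g₀.IsRiemannian → g₀.HasPositiveIsotropicCurvature →
        ∃ ρ Λ P : ℝ, 0 < ρ ∧ 0 < Λ ∧ 0 < P ∧
          ∃ r : ℝ → ℝ, (∀ t ∈ Ici (0 : ℝ), 0 < r t) ∧ AntitoneOn r (Ici 0) ∧
            ∃ (Inv : ChenZhuRestartPred) (h Tmax : ℝ), 0 < h ∧ Inv M g₀ 0 ∧
              ChenZhuSurgicalStepHyp ⟨ε, C₁, C₂, η, ρ, Λ, P, r⟩ Tmax h Inv ∧
              ∀ (cov₀ : CovariantDerivative (𝓡 4) (EuclideanSpace ℝ (Fin 4))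
                  (TangentSpace (𝓡 4) : M → Type _)) (α : ℝ),
                g₀.IsLeviCivita cov₀ → 0 < α →
                (∀ x : M, α ≤ g₀.scalarCurvatureWith cov₀ x) → Tmax ≤ 2 / α

/-- **Assembly (PROVED): Hamilton's Cor. 1.2(a) from Chen–Zhu's surgery step and Cerf's
theorem.** The step gives Thm. 5.6 by the count of p. 43 and then Thm. 1.1
(`chenZhu_ricciFlowWithSurgery_of_step`); Thm. 1.1 and `π₀ Diff(D³ rel ∂) = 0` give the
classification (`hamilton_chen_tang_zhu_of_chenZhu_of_cerfRelBoundary`: reconstruction of the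
manifold from the pieces, Hamilton 1997 §1.1, with Cerf's theorem identifying the cappings).
[cite: ChenZhu2006, Thm. 5.6 and Thm. 1.1 (p. 43)] [cite: Hamilton1997, Cor. 1.2(a) (p. 3)]
[cite: CerfDiffeoSphere1968, Ch. I §2, (2)] -/
theorem hamilton_chen_tang_zhu_holds_of (hstep : chenZhu_surgicalStep_admissibleRestart)
    (hcerf : cerf_pi0DiffDisc_relBoundary_three) : hamilton_chen_tang_zhu :=
  hamilton_chen_tang_zhu_of_chenZhu_of_cerfRelBoundary (chenZhu_ricciFlowWithSurgery_of_step hstep)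
    hcerf

end Literature.Geometry.Riemannian

end
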